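import Mathlib
import Summits.Ventures.PercRepro.TriangleCapFiveRowThreePieces

/-!
# PercRepro — THE ROW `a = 5` AT `r = 3`: a `K₄⁻`-free graph with `5 (k − 5) − 3` edges on `k ≥ 13` vertices is
`5`-bipartite or at least `T = 2k − 22` below the closed form — the one-triangle family is the non-bipartite gap
of the cell `(k, 5, 3)` (p3, gen 46; part 199i)

On `(k, 5, 3)` the stability table §10bt(e) reads `min {B2, T}` with `B2 = 4 (k − 11)` and `T = 2k − 22 < B2` for
`k > 11`: the one-triangle family `K_{5,k−6}` with a vertex hung on an edge (`tFamilyGen (k − 1) 5 0`) is the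
non-bipartite second-best graph. The induction on `k` of parts 195–199d, every vertex type: the cap is part 199g
(`five_three_cap`); every degree in `[6, k − 6]` gives `k (k − 11) ≥ 2 (k − 11)` by the convexity of the row `6`
(`below_convex_gen`); a vertex `z` of degree `d ≤ 5` is deleted (part 199h): `d = 0` is impossible at `k = 13`
(`4 · 37 > 144`) and the closed form on `(k − 1, 6, k − 14)` beyond; `d = 1` the closed form on `(k − 1, 6, k − 13)`;
`d = 2` the diagonal `(k − 1, 5, 0)`; `d = 3` the cell `(k − 1, 5, 1)`; `d = 4` the cell `(k − 1, 5, 2)`; `d = 5` the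
cell `(k − 1, 5, 3)` — the induction hypothesis for `k ≥ 14` and, AT THE CORNER `k = 13`, the third order on the
diagonal `(12, 32)` of part 199f (`four_diag_third_order_twelve`: `D − z = K_{4,8}`, whose five neighbours of `z` lie
off the `4`-side, so `D` is `5`-bipartite; or `5`-bipartite; or at most `358` — the hung `K_{5,6}` deleted from the
family `T` on `(13, 5, 3)`, exact). `five_three_corner`: on `(13, 5, 3)` every non-`5`-bipartite graph has
`Σ_v d(v)² ≤ 450 = closed − 4`. Axioms: standard.
-/

namespace PercRepro

namespace TriangleCap

namespace C047

open Finset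

universe u

variable {V : Type*} [Fintype V] [DecidableEq V]

/-- **THE ROW `a = 5` AT `r = 3`, EVERY VERTEX TYPE, BY INDUCTION ON `k`:** `K₄⁻`-free, `m + 3 = 5 (k − 5)`,
`13 ≤ k` ⇒ `5`-bipartite or `Σ_v d(v)² + 3 (k − 4) + (2k − 22) ≤ m k`. -/
theorem five_three_second_order_aux (n : ℕ) :
    ∀ (W : Type u) [Fintype W] [DecidableEq W] (D : SimpleGraph W) [DecidableRel D.Adj], Fintype.card W = n →
      K4mFree D → 13 ≤ Fintype.card W → D.edgeFinset.card + 3 = 5 * (Fintype.card W - 5) →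
      (∃ A : Finset W, A.card = 5 ∧ BipSub D A) ∨
        ∑ v, deg D v * deg D v + 3 * (Fintype.card W - 4) + (2 * Fintype.card W - 22) ≤
          D.edgeFinset.card * Fintype.card W := by
  refine Nat.strong_induction_on n ?_
  intro n ih W _ _ D _ hn hK hk hm
  -- (A) a vertex at the cap `k − 5`
  by_cases hx : ∃ x, deg D x + 5 = Fintype.card W
  · obtain ⟨x, hx⟩ := hx
    exact five_three_cap D hK hk hm x hx
  push Not at hx
  have hcap : ∀ v, deg D v + 5 ≤ Fintype.card W := fun v =>
    deg_add_le_card_of_dense D hK 5 (by norm_num) (by omega)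
      (cap_arith 5 (Fintype.card W) D.edgeFinset.card 3 (by norm_num) (by omega) (by omega)) v
  have hcap' : ∀ v, deg D v + 5 + 1 ≤ Fintype.card W := fun v => by
    have h1 := hcap v
    have h2 := hx v
    omega
  have hcap7 : ∀ v, deg D v ≤ (Fintype.card W - 7) + 1 := fun v => by have := hcap' v; omega
  -- (B) every degree `≥ 6`: the convexity of the row `6`
  by_cases hdeg : ∀ v, 5 + 1 ≤ deg D v
  · right
    have h := below_convex_gen D 5 3 (by norm_num) (by omega) hm hcap' hdeg
    have h2 : 2 * (Fintype.card W - 2 * 5 - 1) ≤ Fintype.card W * (Fintype.card W - 2 * 5 - 1) :=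
      Nat.mul_le_mul_right _ (by omega)
    omega
  push Not at hdeg
  obtain ⟨z, hz⟩ := hdeg
  -- the deletion bookkeeping
  have hK' := k4mFree_del D hK z
  have hcard' := card_del z
  have hedges' := card_edges_del D z
  have hsq := sum_deg_sq_del D z
  have hT := sum_del_nbhd_le D z (Fintype.card W - 7) hcap7
  have hNz := card_nbhd_del D z
  obtain ⟨T, hTdef⟩ : ∃ T, ∑ a : {v : W // v ≠ z}, (if D.Adj a.1 z then deg (del D z) a else 0) = T := ⟨_, rfl⟩
  obtain ⟨S', hS'def⟩ : ∃ S', ∑ a : {v : W // v ≠ z}, deg (del D z) a * deg (del D z) a = S' := ⟨_, rfl⟩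
  obtain ⟨m', hm'def⟩ : ∃ m', (del D z).edgeFinset.card = m' := ⟨_, rfl⟩
  obtain ⟨Nz, hNzdef⟩ : ∃ Nz : Finset {v : W // v ≠ z},
      Nz = univ.filter (fun a : {v : W // v ≠ z} => D.Adj a.1 z) := ⟨_, rfl⟩
  have hmemNz : ∀ a : {v : W // v ≠ z}, a ∈ Nz ↔ D.Adj a.1 z := fun a => by
    rw [hNzdef, mem_filter]
    simp only [mem_univ, true_and]
  rw [← hNzdef] at hNz
  rw [hTdef, hS'def] at hsq
  rw [hTdef] at hT
  rw [hm'def] at hedges'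
  obtain ⟨s, hs⟩ : ∃ s, Fintype.card W = s + 13 := ⟨Fintype.card W - 13, by omega⟩
  have hcardW' : Fintype.card {v : W // v ≠ z} = s + 12 := by omega
  -- the side lemma for a `5`-bipartite `D − z`
  have hside : ∀ A' : Finset {v : W // v ≠ z}, A'.card = 5 → BipSub (del D z) A' →
      (∃ A : Finset W, A.card = 5 ∧ BipSub D A) ∨
        (∑ v, deg D v * deg D v + 3 * (Fintype.card W - 4) + (2 * Fintype.card W - 22) ≤
          D.edgeFinset.card * Fintype.card W) ∨
        (T + (Fintype.card W - 7) ≤ deg D z * (Fintype.card W - 7) + 5) := by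
    intro A' hA'card hB
    have := five_three_sides D hk hm z A' hA'card hB hcap7
    rw [hTdef] at this
    exact this
  have hd : deg D z = 0 ∨ deg D z = 1 ∨ deg D z = 2 ∨ deg D z = 3 ∨ deg D z = 4 ∨ deg D z = 5 := by omega
  rcases hd with hd0 | hd1 | hd2 | hd3 | hd4 | hd5
  · -- `d = 0`
    right
    have hm'0 : m' = 5 * s + 37 := by omega
    rcases Nat.eq_zero_or_pos s with hs0 | hspos
    · -- `k = 13`: `37` edges on `12` vertices, impossible
      exfalso
      subst hs0
      have h := four_mul_card_edges_le_sq (del D z) hK' (by omega)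
      rw [hm'def, hcardW'] at h
      omega
    · -- `k ≥ 14`: the closed form on `(k − 1, 6, k − 14)`
      have h := closed_form_stability (del D z) hK' 6 (s + 13 - 14) (by norm_num) (by rw [hcardW']; omega)
        (by rw [hm'def, hcardW', hm'0]; omega)
      rw [hS'def, hm'def, hcardW'] at h
      have e : s + 12 - 1 - (s + 13 - 14) = 12 := by omega
      rw [e] at h
      rw [hd0, hs] at hT
      rw [hsq, ← hedges', hs, hd0]
      exact five_three_del_zero_arith s m' S' T hspos hm'0 h hT
  · -- `d = 1`: the closed form on `(k − 1, 6, k − 13)`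
    right
    have hm'1 : m' = 5 * s + 36 := by omega
    have h := closed_form_stability (del D z) hK' 6 (s + 13 - 13) (by norm_num) (by rw [hcardW']; omega)
      (by rw [hm'def, hcardW', hm'1]; omega)
    rw [hS'def, hm'def, hcardW'] at h
    have e : s + 12 - 1 - (s + 13 - 13) = 11 := by omega
    rw [e] at h
    rw [hd1, hs] at hT
    rw [hsq, ← hedges', hs, hd1]
    exact five_three_del_one_arith s m' S' T hm'1 h hT
  · -- `d = 2`: the diagonal `(k − 1, 5, 0)` at second order
    have hm'2 : m' = 5 * s + 35 := by omega
    rcases diag_second_order_gen (del D z) hK' 5 (by norm_num) (by omega) (by rw [hm'def, hcardW', hm'2]; omega)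
      with ⟨A', hA'card, hB⟩ | hgap
    · rcases hside A' hA'card hB with h | h | hT'
      · exact Or.inl h
      · exact Or.inr h
      · right
        have henv := sum_deg_sq_le_of_k4mFree (del D z) hK' (by omega)
        rw [hS'def, hm'def, hcardW'] at henv
        rw [hs, hd2] at hT'
        rw [hsq, ← hedges', hs, hd2]
        exact five_three_del_two_mixed_arith s m' S' T hm'2 henv hT'
    · right
      rw [hS'def, hm'def, hcardW'] at hgap
      rw [hd2, hs] at hT
      rw [hsq, ← hedges', hs, hd2]
      exact five_three_del_two_gap_arith s m' S' T hm'2 hgap hT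
  · -- `d = 3`: the cell `(k − 1, 5, 1)`
    have hm'3 : m' = 5 * s + 34 := by omega
    rcases one_below_second_order_gen (del D z) hK' 5 (by norm_num) (by omega)
      (by rw [hm'def, hcardW', hm'3]; omega) with ⟨A', hA'card, hB⟩ | hgap
    · rcases hside A' hA'card hB with h | h | hT'
      · exact Or.inl h
      · exact Or.inr h
      · right
        have hS := sum_deg_sq_le_of_bipSub (del D z) A' hB 5 1 hA'card (by rw [hm'def, hcardW', hm'3]; omega)
          (by omega)
        rw [hS'def, hm'def, hcardW'] at hS
        rw [hs, hd3] at hT'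
        rw [hsq, ← hedges', hs, hd3]
        exact five_three_del_three_mixed_arith s m' S' T hm'3 hS hT'
    · right
      rw [hS'def, hm'def, hcardW'] at hgap
      rw [hd3, hs] at hT
      rw [hsq, ← hedges', hs, hd3]
      exact five_three_del_three_gap_arith s m' S' T hm'3 hgap hT
  · -- `d = 4`: the cell `(k − 1, 5, 2)`
    have hm'4 : m' = 5 * s + 33 := by omega
    rcases below_second_order_gen (del D z) hK' 5 2 (by norm_num) (by norm_num) (by norm_num) (by omega)
      (by rw [hm'def, hcardW', hm'4]; omega) with ⟨A', hA'card, hB⟩ | hgap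
    · rcases hside A' hA'card hB with h | h | hT'
      · exact Or.inl h
      · exact Or.inr h
      · right
        have hS := sum_deg_sq_le_of_bipSub (del D z) A' hB 5 2 hA'card (by rw [hm'def, hcardW', hm'4]; omega)
          (by omega)
        rw [hS'def, hm'def, hcardW'] at hS
        rw [hs, hd4] at hT'
        rw [hsq, ← hedges', hs, hd4]
        exact five_three_del_four_mixed_arith s m' S' T hm'4 hS hT'
    · right
      rw [hS'def, hm'def, hcardW'] at hgap
      rw [hd4, hs] at hT
      rw [hsq, ← hedges', hs, hd4]
      exact five_three_del_four_gap_arith s m' S' T hm'4 hgap hT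
  · -- `d = 5`: the cell `(k − 1, 5, 3)`
    have hm'5 : m' = 5 * s + 32 := by omega
    rcases Nat.eq_zero_or_pos s with hs0 | hspos
    · -- the corner `k = 13`: `D − z` on `(12, 32)` at third order
      subst hs0
      have hk13 : Fintype.card W = 13 := by omega
      have hcard12 : Fintype.card {v : W // v ≠ z} = 12 := by omega
      have hm'32 : m' = 32 := by omega
      rcases four_diag_third_order_twelve (del D z) hK' hcard12 (by rw [hm'def, hm'32])
        with ⟨A', hA'card, hA'⟩ | ⟨A', hA'card, hB⟩ | hthird
      · -- `D − z = K_{4,8}`: the five neighbours of `z` lie off the `4`-side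
        have hfull : ∀ {x y : {v : W // v ≠ z}}, x ∈ A' → y ∉ A' → (del D z).Adj x y := fun hx hy =>
          adj_of_bipSub_full (del D z) A' hA' 4 hA'card (by rw [hm'def, hcard12, hm'32]) hx hy
        have hall : ¬ ∀ a : {v : W // v ≠ z}, D.Adj a.1 z → a ∈ A' := by
          intro hall
          have hsub : Nz ⊆ A' := fun a ha => hall a ((hmemNz a).mp ha)
          have := card_le_card hsub
          omega
        push Not at hall
        obtain ⟨a₀, ha₀z, ha₀A⟩ := hall
        have hoff : ∀ a : {v : W // v ≠ z}, D.Adj a.1 z → a ∉ A' := by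
          intro a₁ ha₁z ha₁A
          have hne01 : a₀ ≠ a₁ := fun h => ha₀A (h ▸ ha₁A)
          obtain ⟨a₂, ha₂z, ha₂0, ha₂1⟩ : ∃ a₂ : {v : W // v ≠ z}, D.Adj a₂.1 z ∧ a₂ ≠ a₀ ∧ a₂ ≠ a₁ := by
            have h2 : 2 < Nz.card := by omega
            obtain ⟨b₁, hb₁, b₂, hb₂, b₃, hb₃, h12, h13, h23⟩ := two_lt_card.mp h2
            rw [hmemNz] at hb₁ hb₂ hb₃
            by_cases e1 : b₁ = a₀ ∨ b₁ = a₁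
            · by_cases e2 : b₂ = a₀ ∨ b₂ = a₁
              · refine ⟨b₃, hb₃, ?_, ?_⟩
                · intro h; rcases e1 with rfl | rfl <;> rcases e2 with rfl | rfl <;>
                    first | exact h12 rfl | exact h13 h | exact h13 h.symm | exact h23 h | exact h23 h.symm
                · intro h; rcases e1 with rfl | rfl <;> rcases e2 with rfl | rfl <;>
                    first | exact h12 rfl | exact h13 h | exact h13 h.symm | exact h23 h | exact h23 h.symm
              · push Not at e2
                exact ⟨b₂, hb₂, e2.1, e2.2⟩
            · push Not at e1
              exact ⟨b₁, hb₁, e1.1, e1.2⟩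
          have h10 : D.Adj a₁.1 a₀.1 := (del_adj D z a₁ a₀).mp (hfull ha₁A ha₀A)
          by_cases ha₂A : a₂ ∈ A'
          · have h20 : D.Adj a₂.1 a₀.1 := (del_adj D z a₂ a₀).mp (hfull ha₂A ha₀A)
            exact not_adj_both D hK (D.adj_symm ha₀z) (D.adj_symm ha₁z) (D.adj_symm h10)
              (fun h => ha₂1 (Subtype.ext h).symm) (D.adj_symm ha₂z) (D.adj_symm h20)
          · have h12' : D.Adj a₁.1 a₂.1 := (del_adj D z a₁ a₂).mp (hfull ha₁A ha₂A)
            exact not_adj_both D hK (D.adj_symm ha₁z) (D.adj_symm ha₀z) h10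
              (fun h => ha₂0 (Subtype.ext h).symm) (D.adj_symm ha₂z) h12'
        obtain ⟨B, hBcard, hB⟩ := bipSub_insert_of_nbhd_off D z A' hA' hoff
        exact Or.inl ⟨B, by rw [hBcard, hA'card], hB⟩
      · -- `D − z` is `5`-bipartite on `(12, 5, 3)`
        rcases hside A' hA'card hB with h | h | hT'
        · exact Or.inl h
        · exact Or.inr h
        · right
          have hS := sum_deg_sq_le_of_bipSub (del D z) A' hB 5 3 hA'card (by rw [hm'def, hcard12, hm'32])
            (by omega)
          rw [hS'def, hm'def, hcard12, hm'32] at hS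
          rw [hk13, hd5] at hT'
          rw [hsq, ← hedges', hk13, hd5, hm'32]
          omega
      · -- `D − z` neither `4`- nor `5`-bipartite: at most `358`
        right
        rw [hS'def, hm'def, hcard12, hm'32] at hthird
        rw [hd5, hk13] at hT
        rw [hsq, ← hedges', hk13, hd5, hm'32]
        omega
    · -- `k ≥ 14`: the induction hypothesis on `(k − 1, 5, 3)`
      rcases ih (Fintype.card {v : W // v ≠ z}) (by omega) {v : W // v ≠ z} (del D z) rfl hK' (by omega)
        (by rw [hm'def, hcardW', hm'5]; omega) with ⟨A', hA'card, hB⟩ | hgap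
      · rcases hside A' hA'card hB with h | h | hT'
        · exact Or.inl h
        · exact Or.inr h
        · right
          have hS := sum_deg_sq_le_of_bipSub (del D z) A' hB 5 3 hA'card (by rw [hm'def, hcardW', hm'5]; omega)
            (by omega)
          rw [hS'def, hm'def, hcardW'] at hS
          rw [hs, hd5] at hT'
          rw [hsq, ← hedges', hs, hd5]
          exact five_three_del_five_mixed_arith s m' S' T hm'5 hS hT'
      · right
        rw [hS'def, hm'def, hcardW'] at hgap
        rw [hd5, hs] at hT
        rw [hsq, ← hedges', hs, hd5]
        exact five_three_del_five_gap_arith s m' S' T hm'5 hgap hT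

/-- **THE ROW `a = 5` AT `r = 3` AT SECOND ORDER:** `K₄⁻`-free, `m + 3 = 5 (k − 5)`, `13 ≤ k` ⇒ `D` is a spanning
subgraph of some `K(A, Aᶜ)` with `|A| = 5`, or `Σ_v d(v)² + 3 (k − 4) + (2k − 22) ≤ m k` (the one-triangle gap
`T = 2k − 22`). -/
theorem five_three_second_order (D : SimpleGraph V) [DecidableRel D.Adj] (hK : K4mFree D)
    (hk : 13 ≤ Fintype.card V) (hm : D.edgeFinset.card + 3 = 5 * (Fintype.card V - 5)) :
    (∃ A : Finset V, A.card = 5 ∧ BipSub D A) ∨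
      ∑ v, deg D v * deg D v + 3 * (Fintype.card V - 4) + (2 * Fintype.card V - 22) ≤
        D.edgeFinset.card * Fintype.card V :=
  five_three_second_order_aux (Fintype.card V) V D rfl hK hk hm

/-- **THE CORNER `(13, 5, 3)`:** a `K₄⁻`-free graph with `37` edges on `13` vertices is `5`-bipartite or has
`Σ_v d(v)² ≤ 450 = m k − 3 (k − 4) − 4` (the family `T`: the hung `K_{5,7}`). -/
theorem five_three_corner (D : SimpleGraph V) [DecidableRel D.Adj] (hK : K4mFree D)
    (hk : Fintype.card V = 13) (hm : D.edgeFinset.card = 37) :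
    (∃ A : Finset V, A.card = 5 ∧ BipSub D A) ∨ ∑ v, deg D v * deg D v ≤ 450 := by
  rcases five_three_second_order D hK (by omega) (by omega) with h | h
  · exact Or.inl h
  · right
    rw [hk, hm] at h
    omega

/-- **THE NON-BIPARTITE SECOND-BEST VALUE ON `(k, 5, 3)`, `k ≥ 13`:** every non-`5`-bipartite `K₄⁻`-free graph on
`Fin k` with `5 (k − 5) − 3` edges has `Σ_v d(v)² + 3 (k − 4) + (2k − 22) ≤ m k`, and the value is attained by the
one-triangle family `tFamilyGen (k − 1) 5 0` (`K_{5,k−6}` with a vertex hung on an edge), bipartite for no `A`. -/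
theorem five_three_nonbip_second_best (k : ℕ) (hk : 13 ≤ k) :
    (∀ (D : SimpleGraph (Fin k)) [DecidableRel D.Adj], K4mFree D → D.edgeFinset.card + 3 = 5 * (k - 5) →
        (¬ ∃ A : Finset (Fin k), A.card = 5 ∧ BipSub D A) →
        ∑ v, deg D v * deg D v + 3 * (k - 4) + (2 * k - 22) ≤ D.edgeFinset.card * k) ∧
      ∃ (D : SimpleGraph (Fin k)) (_ : DecidableRel D.Adj), K4mFree D ∧ D.edgeFinset.card + 3 = 5 * (k - 5) ∧
        (∀ A : Finset (Fin k), ¬ BipSub D A) ∧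
        ∑ v, deg D v * deg D v + 3 * (k - 4) + (2 * k - 22) = D.edgeFinset.card * k := by
  have hcard : Fintype.card (Fin k) = k := Fintype.card_fin k
  refine ⟨?_, ?_⟩
  · intro D _ hK hm hnb
    rcases five_three_second_order D hK (by omega) (by rw [hcard]; exact hm) with h | h
    · exact absurd h hnb
    · rw [hcard] at h
      exact h
  · obtain ⟨n, rfl⟩ : ∃ n, k = n + 1 := ⟨k - 1, by omega⟩
    obtain ⟨hK, hE, hS, hnb⟩ := tFamilyGen_value n 5 0 (by norm_num) (by omega) (by omega)
    refine ⟨tFamilyGen n 5 0 (by omega), inferInstance, hK, ?_, hnb, ?_⟩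
    · have e : 0 + 5 - 2 = 3 := by norm_num
      rw [e] at hE
      have e2 : n + 1 - 5 = n - 4 := by omega
      rw [e2]
      have e3 : n - 4 = n + 1 - 5 := by omega
      rw [e3]
      exact hE
    · have e : 0 + 5 - 2 = 3 := by norm_num
      rw [e] at hS
      have e1 : n + 1 - 1 - 3 = n + 1 - 4 := by omega
      have e2 : 2 * (n - 2 * 5) + 2 * 0 * (5 - 3) = 2 * (n + 1) - 22 := by omega
      rw [e1] at hS
      omega

end C047

end TriangleCap

end PercRepro
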